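import Summits.AtomisticToContinuum.BoseEinsteinCondensation.Theses.BECGroundStateSOS
import Summits.AtomisticToContinuum.BoseEinsteinCondensation.Theorems.GaussianDominationCan.Negative.CruxForms
import Summits.AtomisticToContinuum.BoseEinsteinCondensation.Theorems.CorrectorClosure.Negative.InsertionResidueHardCoreJamming
import Literature.MathematicalPhysics.QuantumManyBody.PeriodicBoseGasFracEnergy
import Literature.Barriers.AtomisticToContinuum.KineticGapLengthScalesThermodynamicWindow

/-!
# Negative lemmas for crux `PeriodicIRBound` (stmt-AtomisticToContinuum-3972), I: the crux unfolded and
the two-mode witness states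

Supports (does not close) stmt-AtomisticToContinuum-3972, route `BECGroundStateSOS`
(`Summit.AtomisticToContinuum.BoseEinsteinCondensation.Theses.BECGroundStateSOS.PeriodicIRBound`, the
T = 0 infrared bound `n_k(Ψ) ≤ C√ρ L_N/‖k‖_∞` for `δ`-near-minimisers of the periodic `N`-body energy on
the torus of side `L_N = (N/ρ)^{1/3}`, `0 < ‖k‖_∞ ≤ κ√ρ L_N`). Landed copy of §1–§4 of the crux
disprover's work file `Cruxes/PeriodicIRBound/Disproof.lean` (cycle 1); all `sorry`-free.

* §1 `periodicIRBound_iff` — the crux is `∀ v admissible, IRBoundFor v` (pieces `NearMin`, `InWindow`,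
  `IRIneq`; `irIneq_iff`: the inlined mode is `planeWaveMode`).
* §2 `cellOccupation_symFun` — exact occupation of the two-mode product states `(a + b e_n)^{⊗N}` of
  `GaussianDominationCan.Negative.symState`: `n_n = N b² L³`.
* §3 the witness family `twoMode t`, `t ∈ [0,1]`: `n_n = N t` (`cellOccupation_twoMode`), free energy
  `N t |2πn/L|²` (`periodicEnergy_zero_twoMode`).
* §4 asymptotics along the thermodynamic box (`eventually_one_le_window`, `eventually_bound_lt_N`,
  `eventually_bound_lt_sq`, `eventually_sq_le_N`).

Sequel files: `LoadBearing` (§5–§8), `FreeGas` (§9–§10).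
-/

noncomputable section

open MeasureTheory Filter
open scoped ENNReal NNReal ComplexConjugate BigOperators
namespace Summit.AtomisticToContinuum.BoseEinsteinCondensation.Theorems.PeriodicIRBound.Negative

open Literature.MathematicalPhysics.QuantumManyBody.BoseGas
open Summit.AtomisticToContinuum.BoseEinsteinCondensation.Theses.BECGroundStateSOS
open Summit.AtomisticToContinuum.BoseEinsteinCondensation.Theorems.GaussianDominationCan.Negative
  (symState symFun oneBody periodicEnergy_symState nsq nsq_nonneg e0 e0_ne_zero norm_e0
    nsq_e0 one_le_norm_intVec lintegral_nnnorm_sq_prodFun lintegral_nnnorm_sq_oneBody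
    continuous_oneBody integral_cell_const conj_cellWave_mul_self integral_cell_conj_cellWave
    isRepulsiveFiniteRange_zero)
open Summit.AtomisticToContinuum.BoseEinsteinCondensation.Theorems.GaussianDominationCan.Negative
  renaming prodFun → gdProd
open Summit.AtomisticToContinuum.BoseEinsteinCondensation.Theorems.CorrectorClosure.Negative
  (hardCore isRepulsiveFiniteRange_hardCore periodicEnergy_hardCore_eq_top
    periodicGroundStateEnergy_one_eq_top)

variable {L : ℝ} {m : ℕ} {n : Fin 3 → ℤ} {a b : ℝ}

/-! ## §1 The crux, unfolded into named pieces -/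

/-- The crux's one-body mode `L^{-3/2} e_k` is the normalised plane wave `planeWaveMode L k` of
`PeriodicBoseGasFracEnergy`. [folklore] -/
theorem mode_eq (L : ℝ) (k : Fin 3 → ℤ) :
    (fun x => ((Real.sqrt (L ^ 3))⁻¹ : ℂ) * cellWave L k x) = planeWaveMode L k :=
  funext fun x => (planeWaveMode_eq L k x).symm

/-- The near-minimiser hypothesis of the crux (slack `δ`, torus of side `L_N = (N/ρ)^{1/3}`). -/
def NearMin (v : ℝ → ℝ≥0∞) (ρ : ℝ) (N : ℕ) (δ : ℝ≥0∞)
    (Ψ : PeriodicTrialState N (sideLength ρ N)) : Prop :=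
  periodicEnergy v Ψ ≤ periodicGroundStateEnergy v N (sideLength ρ N) + δ

/-- The momentum window of the crux: `k ≠ 0`, `‖k‖_∞ ≤ κ √ρ L_N`. -/
def InWindow (κ ρ : ℝ) (N : ℕ) (k : Fin 3 → ℤ) : Prop :=
  k ≠ 0 ∧ ‖(fun j => (k j : ℝ))‖ ≤ κ * Real.sqrt ρ * sideLength ρ N

/-- The infrared inequality of the crux for one `N`-body function and one mode:
`n_k(Ψ) ≤ C √ρ L_N / ‖k‖_∞`. -/
def IRIneq (C ρ : ℝ) (N : ℕ) (Ψ : Config N → ℂ) (k : Fin 3 → ℤ) : Prop :=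
  cellOccupation N (sideLength ρ N)
      (fun x => ((Real.sqrt (sideLength ρ N ^ 3))⁻¹ : ℂ) * cellWave (sideLength ρ N) k x) Ψ ≤
    ENNReal.ofReal (C * Real.sqrt ρ * sideLength ρ N / ‖(fun j => (k j : ℝ))‖)

/-- The crux for ONE potential `v`. -/
def IRBoundFor (v : ℝ → ℝ≥0∞) : Prop :=
  ∀ κ : ℝ, 0 < κ → ∃ ρ₀ : ℝ, 0 < ρ₀ ∧ ∃ C : ℝ, 0 < C ∧ ∀ ρ : ℝ, 0 < ρ → ρ < ρ₀ →
    ∀ᶠ N : ℕ in atTop, ∃ δ : ℝ≥0∞, 0 < δ ∧ ∀ Ψ : PeriodicTrialState N (sideLength ρ N),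
      NearMin v ρ N δ Ψ → ∀ k : Fin 3 → ℤ, InWindow κ ρ N k → IRIneq C ρ N Ψ.ψ k

/-- `PeriodicIRBound` is `∀ v admissible, IRBoundFor v` (definitional, up to currying the window). [folklore] -/
theorem periodicIRBound_iff : PeriodicIRBound ↔ ∀ v, IsRepulsiveFiniteRange v → IRBoundFor v := by
  unfold PeriodicIRBound IRBoundFor NearMin InWindow IRIneq
  constructor
  · intro h v hv κ hκ
    obtain ⟨ρ₀, hρ₀, C, hC, h⟩ := h v hv κ hκ
    refine ⟨ρ₀, hρ₀, C, hC, fun ρ hρ hρρ₀ => ?_⟩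
    filter_upwards [h ρ hρ hρρ₀] with N ⟨δ, hδ, hN⟩
    exact ⟨δ, hδ, fun Ψ hΨ k hk => hN Ψ hΨ k hk.1 hk.2⟩
  · intro h v hv κ hκ
    obtain ⟨ρ₀, hρ₀, C, hC, h⟩ := h v hv κ hκ
    refine ⟨ρ₀, hρ₀, C, hC, fun ρ hρ hρρ₀ => ?_⟩
    filter_upwards [h ρ hρ hρρ₀] with N ⟨δ, hδ, hN⟩
    exact ⟨δ, hδ, fun Ψ hΨ k hk hkw => hN Ψ hΨ k ⟨hk, hkw⟩⟩

/-- `IRIneq` through `planeWaveMode`. [folklore] -/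
theorem irIneq_iff (C ρ : ℝ) (N : ℕ) (Ψ : Config N → ℂ) (k : Fin 3 → ℤ) :
    IRIneq C ρ N Ψ k ↔ cellOccupation N (sideLength ρ N) (planeWaveMode (sideLength ρ N) k) Ψ ≤
      ENNReal.ofReal (C * Real.sqrt ρ * sideLength ρ N / ‖(fun j => (k j : ℝ))‖) := by
  rw [IRIneq, mode_eq]

/-! ## §2 Occupations of the two-mode product states `(a + b e_n)^{⊗N}` -/

/-- Slicing the product: `φ^{⊗(m+1)}(x, Y) = φ(x) · φ^{⊗m}(Y)`. [folklore] -/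
theorem symFun_vecCons (x : Space) (Y : Config m) :
    symFun m L n a b (Matrix.vecCons x Y) =
      oneBody L n a b x * gdProd (fun _ : Fin m => oneBody L n a b) Y := by
  unfold symFun Theorems.GaussianDominationCan.Negative.prodFun
  rw [Fin.prod_univ_succ]
  simp only [Matrix.cons_val_zero, Matrix.cons_val_succ]

/-- `∫_cell conj(L^{-3/2} e_n) (a + b e_n) = b √(L³)` (`n ≠ 0`). [folklore] -/
theorem integral_conj_planeWaveMode_mul_oneBody (hL : 0 < L) (hn : n ≠ 0) (a b : ℝ) :
    ∫ x in cell L, conj (planeWaveMode L n x) * oneBody L n a b x =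
      ((b * Real.sqrt (L ^ 3) : ℝ) : ℂ) := by
  have hL3 : (0 : ℝ) < L ^ 3 := by positivity
  set s : ℂ := ((Real.sqrt (L ^ 3) : ℝ) : ℂ) with hsdef
  have hne : s ≠ 0 := by
    rw [hsdef, Complex.ofReal_ne_zero]; exact (Real.sqrt_pos.2 hL3).ne'
  have h : ∀ x, conj (planeWaveMode L n x) * oneBody L n a b x =
      (s⁻¹ * a : ℂ) * conj (cellWave L n x) + (s⁻¹ * b : ℂ) := by
    intro x
    rw [planeWaveMode_eq, map_mul]
    unfold oneBody
    have hc : conj (s⁻¹) = s⁻¹ := by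
      rw [map_inv₀, hsdef, Complex.conj_ofReal]
    rw [hc]
    have := conj_cellWave_mul_self L n x
    linear_combination (s⁻¹ * b : ℂ) * this
  simp_rw [h]
  rw [integral_add (integrableOn_cell (f := fun x => (s⁻¹ * a : ℂ) *
      conj (cellWave L n x)) (by fun_prop)) (integrableOn_cell (f := fun _ => _) continuous_const),
    integral_const_mul, integral_cell_conj_cellWave hL hn, mul_zero, zero_add,
    integral_cell_const hL]
  have hs : ((L : ℂ)) ^ 3 = s * s := by
    rw [hsdef, ← Complex.ofReal_mul, Real.mul_self_sqrt hL3.le]; push_cast; ring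
  rw [hs]
  push_cast
  rw [← hsdef]
  field_simp

/-- **Occupation of mode `n` in `(a + b e_n)^{⊗(m+1)}`**: `(m+1) · b² L³` (normalisation
`(a² + b²) L³ = 1`). [folklore] -/
theorem cellOccupation_symFun (hL : 0 < L) (hn : n ≠ 0) (hab : (a ^ 2 + b ^ 2) * L ^ 3 = 1) :
    cellOccupation (m + 1) L (planeWaveMode L n) (symFun m L n a b) =
      ENNReal.ofReal ((m + 1 : ℕ) * (b ^ 2 * L ^ 3)) := by
  have hL3 : (0 : ℝ) < L ^ 3 := by positivity
  rw [cellOccupation_succ]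
  have hinner : ∀ Y : Config m,
      ∫ x in cell L, conj (planeWaveMode L n x) * symFun m L n a b (Matrix.vecCons x Y) =
        ((b * Real.sqrt (L ^ 3) : ℝ) : ℂ) * gdProd (fun _ : Fin m => oneBody L n a b) Y := by
    intro Y
    simp_rw [symFun_vecCons, ← mul_assoc]
    rw [integral_mul_const, integral_conj_planeWaveMode_mul_oneBody hL hn]
  simp_rw [hinner]
  have hsq : ∀ Y : Config m,
      ((‖((b * Real.sqrt (L ^ 3) : ℝ) : ℂ) * gdProd (fun _ : Fin m => oneBody L n a b) Y‖₊ : ℝ≥0∞) ^ 2)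
        = ENNReal.ofReal (b ^ 2 * L ^ 3) *
          ((‖gdProd (fun _ : Fin m => oneBody L n a b) Y‖₊ : ℝ≥0∞) ^ 2) := by
    intro Y
    rw [nnnorm_mul, ENNReal.coe_mul, mul_pow]
    congr 1
    rw [← ENNReal.coe_pow, ENNReal.ofReal, ENNReal.coe_inj]
    ext
    rw [NNReal.coe_pow, coe_nnnorm, Complex.norm_real, Real.norm_eq_abs, sq_abs, mul_pow,
      Real.sq_sqrt hL3.le, Real.coe_toNNReal _ (by positivity)]
  simp_rw [hsq]
  rw [lintegral_const_mul' _ _ ENNReal.ofReal_ne_top,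
    lintegral_nnnorm_sq_prodFun (fun _ => continuous_oneBody L n a b)]
  simp only [lintegral_nnnorm_sq_oneBody hL hn, hab, ENNReal.ofReal_one, Finset.prod_const_one,
    mul_one]
  conv_rhs => rw [ENNReal.ofReal_mul (by positivity), ENNReal.ofReal_natCast]
  push_cast
  ring


/-! ## §3 The witness family `Ψ_t = (√((1-t)/L³) + √(t/L³)·e_n)^{⊗(m+1)}`, `t ∈ [0,1]` -/

/-- Normalisation of the witness family. [folklore] -/
theorem twoMode_norm (hL : 0 < L) {t : ℝ} (ht0 : 0 ≤ t) (ht1 : t ≤ 1) :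
    (Real.sqrt ((1 - t) / L ^ 3) ^ 2 + Real.sqrt (t / L ^ 3) ^ 2) * L ^ 3 = 1 := by
  have hL3 : 0 < L ^ 3 := by positivity
  rw [Real.sq_sqrt (div_nonneg (by linarith) hL3.le), Real.sq_sqrt (div_nonneg ht0 hL3.le)]
  field_simp
  ring

/-- `b² L³ = t` for the witness family. [folklore] -/
theorem twoMode_b_sq (hL : 0 < L) {t : ℝ} (ht0 : 0 ≤ t) : Real.sqrt (t / L ^ 3) ^ 2 * L ^ 3 = t := by
  have hL3 : 0 < L ^ 3 := by positivity
  rw [Real.sq_sqrt (div_nonneg ht0 hL3.le)]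
  field_simp

/-- **The witness family** `Ψ_t = (√((1-t)/L³) + √(t/L³) e_n)^{⊗(m+1)}`: a fraction `t` of EVERY
particle sits coherently in the plane wave `e_n` (`t = 0`: the constant state = free ground state;
`t = 1`: the boosted condensate `L^{-3N/2} ∏ e_n(x_j)`). [folklore] -/
def twoMode (m : ℕ) (hL : 0 < L) (hn : n ≠ 0) (t : ℝ) (ht0 : 0 ≤ t) (ht1 : t ≤ 1) :
    PeriodicTrialState (m + 1) L :=
  symState m hL hn (Real.sqrt ((1 - t) / L ^ 3)) (Real.sqrt (t / L ^ 3)) (twoMode_norm hL ht0 ht1)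

/-- **Occupation of the witness**: `n_n(Ψ_t) = N t` exactly (`N = m + 1`). [folklore] -/
theorem cellOccupation_twoMode (hL : 0 < L) (hn : n ≠ 0) {t : ℝ} (ht0 : 0 ≤ t) (ht1 : t ≤ 1) :
    cellOccupation (m + 1) L (planeWaveMode L n) (twoMode m hL hn t ht0 ht1).ψ =
      ENNReal.ofReal ((m + 1 : ℕ) * t) := by
  show cellOccupation (m + 1) L (planeWaveMode L n) (symFun m L n _ _) = _
  rw [cellOccupation_symFun hL hn (twoMode_norm hL ht0 ht1), twoMode_b_sq hL ht0]

/-- **Free energy of the witness**: `⟨Ψ_t, -ΔΨ_t⟩ = N t · 4π²|n|²/L²` exactly. [folklore] -/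
theorem periodicEnergy_zero_twoMode (hL : 0 < L) (hn : n ≠ 0) {t : ℝ} (ht0 : 0 ≤ t)
    (ht1 : t ≤ 1) :
    periodicEnergy 0 (twoMode m hL hn t ht0 ht1) =
      ENNReal.ofReal ((m + 1 : ℕ) * (t * (4 * Real.pi ^ 2 * nsq n / L ^ 2))) := by
  unfold twoMode
  rw [periodicEnergy_symState hL hn, twoMode_b_sq hL ht0]

/-! ## §4 Asymptotics along the thermodynamic box `L_N = (N/ρ)^{1/3}` -/

/-- The window eventually contains the first shell: `1 ≤ κ √ρ L_N` for large `N`. [folklore] -/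
theorem eventually_one_le_window {ρ κ : ℝ} (hρ : 0 < ρ) (hκ : 0 < κ) :
    ∀ᶠ N : ℕ in atTop, 1 ≤ κ * Real.sqrt ρ * sideLength ρ N :=
  ((tendsto_sideLength_atTop hρ).const_mul_atTop (by positivity : 0 < κ * Real.sqrt ρ)).eventually_ge_atTop 1

/-- The claimed bound at `‖k‖ = 1` is eventually SMALLER than the particle number:
`C √ρ L_N < N` for large `N` (`N = ρ L_N³`). [folklore] -/
theorem eventually_bound_lt_N {ρ : ℝ} (hρ : 0 < ρ) (C : ℝ) :
    ∀ᶠ N : ℕ in atTop, C * Real.sqrt ρ * sideLength ρ N < N := by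
  filter_upwards [(tendsto_sideLength_atTop hρ).eventually_gt_atTop (max 1 (C * Real.sqrt ρ / ρ))]
    with N hN
  have h1 : 1 < sideLength ρ N := lt_of_le_of_lt (le_max_left _ _) hN
  have h2 : C * Real.sqrt ρ / ρ < sideLength ρ N := lt_of_le_of_lt (le_max_right _ _) hN
  have hL : 0 < sideLength ρ N := by linarith
  have h3 : (N : ℝ) = ρ * sideLength ρ N ^ 3 := by
    rw [sideLength_pow_three hρ, mul_div_cancel₀ _ hρ.ne']
  rw [div_lt_iff₀ hρ] at h2
  rw [h3]
  have h4 : sideLength ρ N ^ 2 ≤ sideLength ρ N ^ 3 := by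
    nlinarith
  nlinarith [mul_pos hρ hL]

/-- For every real `d > 0`, eventually `C √ρ L_N < d L_N²` (any `C`). [folklore] -/
theorem eventually_bound_lt_sq {ρ d : ℝ} (hρ : 0 < ρ) (hd : 0 < d) (C : ℝ) :
    ∀ᶠ N : ℕ in atTop, C * Real.sqrt ρ * sideLength ρ N < d * sideLength ρ N ^ 2 := by
  filter_upwards [(tendsto_sideLength_atTop hρ).eventually_gt_atTop (max 0 (C * Real.sqrt ρ / d))]
    with N hN
  have hL : 0 < sideLength ρ N := lt_of_le_of_lt (le_max_left _ _) hN
  have h2 : C * Real.sqrt ρ / d < sideLength ρ N := lt_of_le_of_lt (le_max_right _ _) hN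
  rw [div_lt_iff₀ hd] at h2
  nlinarith

/-- For every real `d`, eventually `d L_N² ≤ N` (`N = ρ L_N³`). [folklore] -/
theorem eventually_sq_le_N {ρ : ℝ} (hρ : 0 < ρ) (d : ℝ) :
    ∀ᶠ N : ℕ in atTop, d * sideLength ρ N ^ 2 ≤ N := by
  filter_upwards [(tendsto_sideLength_atTop hρ).eventually_ge_atTop (max 0 (d / ρ))] with N hN
  have hL : 0 ≤ sideLength ρ N := le_trans (le_max_left _ _) hN
  have h2 : d / ρ ≤ sideLength ρ N := le_trans (le_max_right _ _) hN
  rw [div_le_iff₀ hρ] at h2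
  have h3 : (N : ℝ) = ρ * sideLength ρ N ^ 3 := by
    rw [sideLength_pow_three hρ, mul_div_cancel₀ _ hρ.ne']
  rw [h3]
  nlinarith [sq_nonneg (sideLength ρ N)]

end Summit.AtomisticToContinuum.BoseEinsteinCondensation.Theorems.PeriodicIRBound.Negative

end
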